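import Summits.Schanuel.Schanuel.Theorems.ZilberEacMonicCurvePolyFibres
import HarnessLib

/-!
# Arbitrary base branches, LXIII: rows over a NON-MONIC irreducible plane curve — Bézout by
# Gauss's lemma, pseudo-division, and the normal form of a polynomial fibre value along a place

HONEST FRAMING.  Cell `pub-schanuel` (Zilber's Exponential-Algebraic Closedness, case ladder;
host summit Schanuel), seat 2, gen 31.  Files LIII–LIV (and LX–LXII) assumed the base curve
`C : F(x₀, x₁) = 0` MONIC in `x₁`.  The algebra survives without monicity:
* **`exists_bezout_of_irreducible'`** — `F` irreducible of positive `x₁`-degree (hence primitive;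
  Gauss over `ℂ(x₀)`), `R ≠ 0` with `deg_{x₁} R < deg_{x₁} F`: `U·F + V·R = D(x₀)`, `D ≠ 0`;
* **`exists_pseudo_reduction`** — `a = lc_{x₁}(F)`: `a^N·R = G + H·F` with `deg_{x₁} G < deg F`
  (Mathlib's `cancelLeads`, iterated);
* **`rows_eq_zero_of_eventually_zero_along_place'`**, **`exists_place_normalForm'`** — file LIV's
  Parts A–B verbatim for non-monic `F`;
* **`exists_polyFibre_place_normalForm`** — for `R ∈ ℂ[x₀, x₁]` nonzero somewhere on `C` (hence
  `F ∤ R`, so `G ≠ 0` since `F` is prime and `F ∤ a^N`), along any place `x₀ = s^{-k}`,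
  `x₁ = Φ(s)s^{-M}` of `C`: `R(x₀, x₁) = ψ(s)s^L`, `ψ(0) ≠ 0` (divide `G`'s normal form by the
  polar form of `a(x₀)^N`);
The case certificate and the density theorem for non-monic curves are file LXIV.  [folklore algebra]; nothing here is specific
to Schanuel's conjecture (neither used nor implied); Mantova–Masser's question (PLMS 2024 §1 p. 5)
and EC(3,2) stay OPEN.
-/

noncomputable section

open Filter Topology Set Complex Polynomial
open Literature.NumberTheory.Transcendental Literature.ModelTheory.Zilber
open Literature.ModelTheory.ExponentialFields

set_option linter.dupNamespace false

namespace Summit.Schanuel.Schanuel.Theorems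

section PlaneCurveRows

variable (F : ℂ[X][X])

/-! ## Part A. Bézout and pseudo-division -/

/-- **Bézout for the rows of an irreducible curve, non-monic.**  `F ∈ ℂ[x₀][x₁]` irreducible of
positive `x₁`-degree, `R ≠ 0` with `deg_{x₁} R < deg_{x₁} F`: `U·F + V·R = D(x₀)` with `D ≠ 0`
(`F` is primitive, so irreducible over `ℂ(x₀)` by Gauss's lemma; Bézout there; denominators
cleared). [folklore] -/
theorem exists_bezout_of_irreducible' (R : ℂ[X][X]) (hFirr : Irreducible F) (hn : 1 ≤ F.natDegree)
    (hR : R ≠ 0) (hdeg : R.natDegree < F.natDegree) :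
    ∃ (U V : ℂ[X][X]) (D : ℂ[X]), D ≠ 0 ∧ U * F + V * R = C D := by
  classical
  set i : ℂ[X] →+* FractionRing ℂ[X] := algebraMap ℂ[X] (FractionRing ℂ[X]) with hi_def
  have hi : Function.Injective i := IsFractionRing.injective ℂ[X] (FractionRing ℂ[X])
  have hprim : F.IsPrimitive := hFirr.isPrimitive (by omega)
  have hF'irr : Irreducible (F.map i) :=
    (hprim.irreducible_iff_irreducible_map_fraction_map (K := FractionRing ℂ[X])).1 hFirr
  haveI : IsPrincipalIdealRing (FractionRing ℂ[X])[X] :=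
    EuclideanDomain.to_principal_ideal_domain (R := (FractionRing ℂ[X])[X])
  have hR' : R.map i ≠ 0 := (Polynomial.map_ne_zero_iff hi).2 hR
  have hdeg' : (R.map i).natDegree < (F.map i).natDegree := by
    rwa [Polynomial.natDegree_map_eq_of_injective hi, Polynomial.natDegree_map_eq_of_injective hi]
  have hndvd : ¬ F.map i ∣ R.map i := fun h => by
    have := Polynomial.natDegree_le_of_dvd h hR'
    omega
  obtain ⟨u, v, huv⟩ := hF'irr.coprime_iff_not_dvd.2 hndvd
  obtain ⟨b₁, hb₁, hU⟩ := IsLocalization.integerNormalization_spec (nonZeroDivisors ℂ[X]) u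
  obtain ⟨b₂, hb₂, hV⟩ := IsLocalization.integerNormalization_spec (nonZeroDivisors ℂ[X]) v
  set U₀ : ℂ[X][X] := IsLocalization.integerNormalization (nonZeroDivisors ℂ[X]) u with hU₀
  set V₀ : ℂ[X][X] := IsLocalization.integerNormalization (nonZeroDivisors ℂ[X]) v with hV₀
  refine ⟨C b₂ * U₀, C b₁ * V₀, b₁ * b₂,
    mul_ne_zero (nonZeroDivisors.ne_zero hb₁) (nonZeroDivisors.ne_zero hb₂), ?_⟩
  apply Polynomial.map_injective i hi
  rw [Polynomial.map_add, Polynomial.map_mul, Polynomial.map_mul, Polynomial.map_mul,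
    Polynomial.map_mul, Polynomial.map_C, Polynomial.map_C, hU, hV, Polynomial.map_C,
    Algebra.smul_def, Algebra.smul_def, Polynomial.algebraMap_apply, Polynomial.algebraMap_apply,
    map_mul i, Polynomial.C_mul]
  linear_combination (C (i b₁) * C (i b₂)) * huv

/-- **Pseudo-division** by `F` of positive `x₁`-degree with leading row `a`: for every `R` there are
`G, H` and `N` with `deg_{x₁} G < deg_{x₁} F` and `a^N·R = G + H·F`. [folklore] -/
theorem exists_pseudo_reduction (hn : 1 ≤ F.natDegree) (R : ℂ[X][X]) :
    ∃ (G H : ℂ[X][X]) (N : ℕ), G.natDegree < F.natDegree ∧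
      C (F.leadingCoeff ^ N) * R = G + H * F := by
  suffices key : ∀ (m : ℕ) (R : ℂ[X][X]), R.natDegree ≤ m →
      ∃ (G H : ℂ[X][X]) (N : ℕ), G.natDegree < F.natDegree ∧
        C (F.leadingCoeff ^ N) * R = G + H * F from key _ R le_rfl
  intro m
  induction m with
  | zero =>
    intro R hR
    exact ⟨R, 0, 0, by omega, by simp⟩
  | succ m ih =>
    intro R hR
    by_cases hlt : R.natDegree < F.natDegree
    · exact ⟨R, 0, 0, hlt, by simp⟩
    push Not at hlt
    set R' : ℂ[X][X] := Polynomial.cancelLeads F R with hR'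
    have hR'exp : R' = C F.leadingCoeff * R -
        C R.leadingCoeff * X ^ (R.natDegree - F.natDegree) * F := by
      rw [hR', Polynomial.cancelLeads, Nat.sub_eq_zero_of_le hlt, pow_zero, mul_one]
    have hdeg' : R'.natDegree < R.natDegree :=
      Polynomial.natDegree_cancelLeads_lt_of_natDegree_le_natDegree hlt (by omega)
    obtain ⟨G, H, N, hG, hGH⟩ := ih R' (by omega)
    refine ⟨G, H + C (F.leadingCoeff ^ N) * (C R.leadingCoeff * X ^ (R.natDegree - F.natDegree)),
      N + 1, hG, ?_⟩
    have hR'' : C F.leadingCoeff * R =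
        R' + C R.leadingCoeff * X ^ (R.natDegree - F.natDegree) * F := by
      rw [hR'exp]; ring
    rw [pow_succ, Polynomial.C_mul, mul_assoc, hR'', mul_add, hGH]
    ring

/-! ## Part B. Rows along a place: non-vanishing and the normal form (non-monic `F`) -/

/-- A polynomial of `x₁`-degree `< deg F` vanishing along a place of `F = 0` with `x₀ → ∞` is zero
(`F` irreducible of positive `x₁`-degree; file LIV's lemma without monicity). [folklore] -/
theorem rows_eq_zero_of_eventually_zero_along_place' (hFirr : Irreducible F) (hn : 1 ≤ F.natDegree)
    (G : ℂ[X][X]) (hdeg : G.natDegree < F.natDegree) {k : ℕ} (hk : 1 ≤ k) {x₁ : ℂ → ℂ}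
    (hplace : ∀ᶠ s in 𝓝[≠] (0 : ℂ), (F.map (Polynomial.evalRingHom (s ^ k)⁻¹)).eval (x₁ s) = 0)
    (hG : ∀ᶠ s in 𝓝[≠] (0 : ℂ), (G.map (Polynomial.evalRingHom (s ^ k)⁻¹)).eval (x₁ s) = 0) :
    G = 0 := by
  by_contra hG0
  obtain ⟨U, V, D, hD, hUV⟩ := exists_bezout_of_irreducible' F G hFirr hn hG0 hdeg
  have hx₀ : Tendsto (fun s : ℂ => ‖(s ^ k)⁻¹‖) (𝓝[≠] (0 : ℂ)) atTop := by
    have h1 : Tendsto (fun s : ℂ => s ^ k) (𝓝[≠] (0 : ℂ)) (𝓝[≠] 0) := by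
      refine tendsto_nhdsWithin_iff.2 ⟨?_, ?_⟩
      · have : Tendsto (fun s : ℂ => s ^ k) (𝓝 (0 : ℂ)) (𝓝 (0 ^ k)) :=
          (continuous_pow k).continuousAt.tendsto
        rw [zero_pow (by omega)] at this
        exact this.mono_left nhdsWithin_le_nhds
      · filter_upwards [self_mem_nhdsWithin] with s hs
        exact pow_ne_zero _ hs
    exact (tendsto_norm_inv_nhdsNE_zero_atTop (α := ℂ)).comp h1
  exact not_eventually_rows_eq_zero_of_bezout hD hUV hx₀ hplace hG

/-- **The normal form of a row polynomial along a chart** (pure analysis): if the value of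
`G ∈ ℂ[x₀][x₁]` along `x₀ = s^{-k}`, `x₁ = Φ(s)s^{-M}` (`k ≥ 1`, `Φ` analytic at `0`) is not
eventually zero on the punctured neighbourhood, it is `ψ(s)s^L` with `ψ` analytic, `ψ(0) ≠ 0`,
`L ∈ ℤ` (the value is `g(s)s^{-N}` with `g` analytic; isolated zeros). [folklore] -/
theorem exists_normalForm_of_not_eventually_zero (G : ℂ[X][X]) {k : ℕ} (hk : 1 ≤ k) (M : ℕ)
    {Φ : ℂ → ℂ} (hΦan : AnalyticAt ℂ Φ 0)
    (hG : ¬ ∀ᶠ s in 𝓝[≠] (0 : ℂ), (G.map (Polynomial.evalRingHom (s ^ k)⁻¹)).eval (Φ s * (s ^ M)⁻¹) = 0) :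
    ∃ (ψ : ℂ → ℂ) (L : ℤ), AnalyticAt ℂ ψ 0 ∧ ψ 0 ≠ 0 ∧
      ∀ᶠ s in 𝓝[≠] (0 : ℂ),
        (G.map (Polynomial.evalRingHom (s ^ k)⁻¹)).eval (Φ s * (s ^ M)⁻¹) = ψ s * s ^ L := by
  classical
  set n : ℕ := G.natDegree with hn'
  have hrow : ∀ j : ℕ, ∃ U : ℂ → ℂ, AnalyticAt ℂ U 0 ∧
      ∀ s : ℂ, s ≠ 0 → (G.coeff j).eval (s ^ k)⁻¹ = U s * (s ^ (k * (G.coeff j).natDegree))⁻¹ := by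
    intro j
    obtain ⟨U, hUan, -, hUev⟩ :=
      exists_polarForm_eval (G.coeff j) (U := fun _ : ℂ => (1 : ℂ)) analyticAt_const hk
    refine ⟨U, hUan, fun s hs => ?_⟩
    have h := hUev s hs
    rw [one_mul, inv_pow, inv_pow] at h
    exact h
  choose U hUan hUev using hrow
  set N₁ : ℕ → ℕ := fun j => k * (G.coeff j).natDegree + j * M with hN₁
  set N : ℕ := ∑ j ∈ Finset.range (n + 1), N₁ j with hNdef
  have hN₁le : ∀ j ∈ Finset.range (n + 1), N₁ j ≤ N := fun j hj =>
    Finset.single_le_sum (fun i _ => Nat.zero_le (N₁ i)) hj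
  set g : ℂ → ℂ := fun s => ∑ j ∈ Finset.range (n + 1), U j s * Φ s ^ j * s ^ (N - N₁ j) with hg
  have hid : AnalyticAt ℂ (fun s : ℂ => s) 0 := analyticAt_id
  have hgan : AnalyticAt ℂ g 0 := by
    rw [hg]
    refine Finset.analyticAt_fun_sum _ fun j _ => ?_
    exact ((hUan j).mul (hΦan.pow j)).mul (hid.pow _)
  have hfexp : ∀ s : ℂ, (G.map (Polynomial.evalRingHom (s ^ k)⁻¹)).eval (Φ s * (s ^ M)⁻¹) =
      ∑ j ∈ Finset.range (n + 1), (G.coeff j).eval (s ^ k)⁻¹ * (Φ s * (s ^ M)⁻¹) ^ j := by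
    intro s
    rw [Polynomial.eval_map, Polynomial.eval₂_eq_sum_range]
    rfl
  have hgf : ∀ s : ℂ, s ≠ 0 → (G.map (Polynomial.evalRingHom (s ^ k)⁻¹)).eval (Φ s * (s ^ M)⁻¹) =
      g s * s ^ (-(N : ℤ)) := by
    intro s hs
    rw [hfexp, hg, Finset.sum_mul]
    refine Finset.sum_congr rfl fun j hj => ?_
    rw [hUev j s hs, zpow_neg, zpow_natCast, pow_sub₀ s hs (hN₁le j hj)]
    simp only [hN₁, pow_add, pow_mul, mul_pow, inv_pow]
    field_simp
    ring
  have hg_ne : ¬ ∀ᶠ s in 𝓝 (0 : ℂ), g s = 0 := by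
    intro hg0
    apply hG
    filter_upwards [eventually_nhdsWithin_of_eventually_nhds hg0, self_mem_nhdsWithin] with s hgs hs0
    rw [hgf s hs0, hgs, zero_mul]
  obtain ⟨m, ψ, hψan, hψ0, hgψ⟩ := hgan.exists_eventuallyEq_pow_smul_nonzero_iff.2 hg_ne
  refine ⟨ψ, (m : ℤ) - (N : ℤ), hψan, hψ0, ?_⟩
  filter_upwards [eventually_nhdsWithin_of_eventually_nhds hgψ, self_mem_nhdsWithin] with s h2 hs0
  have hs0' : s ≠ 0 := hs0
  rw [hgf s hs0', h2, sub_zero, smul_eq_mul, zpow_sub₀ hs0', zpow_natCast, zpow_neg, zpow_natCast,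
    div_eq_mul_inv]
  ring

/-- **Normal form along a place, non-monic `F`.**  `F` irreducible of positive `x₁`-degree,
`G ≠ 0` with `deg_{x₁} G < deg F`, the place `x₀ = s^{-k}`, `x₁ = Φ(s)s^{-M}` (`k ≥ 1`, `Φ`
analytic): `G(x₀, x₁) = ψ(s)s^{L}` for small `s ≠ 0`, `ψ` analytic, `ψ(0) ≠ 0`, `L ∈ ℤ`.
[folklore] -/
theorem exists_place_normalForm' (hFirr : Irreducible F) (hn : 1 ≤ F.natDegree) (G : ℂ[X][X])
    (hG : G ≠ 0) (hdeg : G.natDegree < F.natDegree) {k : ℕ} (hk : 1 ≤ k) (M : ℕ) {Φ : ℂ → ℂ}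
    (hΦan : AnalyticAt ℂ Φ 0)
    (hplace : ∀ᶠ s in 𝓝[≠] (0 : ℂ),
      (F.map (Polynomial.evalRingHom (s ^ k)⁻¹)).eval (Φ s * (s ^ M)⁻¹) = 0) :
    ∃ (ψ : ℂ → ℂ) (L : ℤ), AnalyticAt ℂ ψ 0 ∧ ψ 0 ≠ 0 ∧
      ∀ᶠ s in 𝓝[≠] (0 : ℂ),
        (G.map (Polynomial.evalRingHom (s ^ k)⁻¹)).eval (Φ s * (s ^ M)⁻¹) = ψ s * s ^ L :=
  exists_normalForm_of_not_eventually_zero G hk M hΦan fun hev =>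
    hG (rows_eq_zero_of_eventually_zero_along_place' F hFirr hn G hdeg hk hplace hev)

/-! ## Part C. The value of a polynomial fibre along a place -/

/-- **`F ∤ R` when `R` is nonzero somewhere on the curve.** [folklore] -/
theorem not_dvd_of_exists_eval_ne_zero {R : ℂ[X][X]}
    (hR : ∃ x y : ℂ, (F.map (Polynomial.evalRingHom x)).eval y = 0 ∧
      (R.map (Polynomial.evalRingHom x)).eval y ≠ 0) : ¬ F ∣ R := by
  rintro ⟨S, rfl⟩
  obtain ⟨x, y, hF, hR⟩ := hR
  exact hR (by rw [Polynomial.map_mul, Polynomial.eval_mul, hF, zero_mul])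

/-- **The value of `R ∈ ℂ[x₀][x₁]` along a place of an irreducible curve is `ψ(s)s^L`** (`F`
irreducible of positive `x₁`-degree, `F ∤ R`; the place `x₀ = s^{-k}`, `x₁ = Φ(s)s^{-M}`, `k ≥ 1`):
pseudo-division `a^N R = G + H F` with `G ≠ 0` (as `F` is prime and `F ∤ a^N`), the normal form of
`G`, and the polar form `a(s^{-k}) = u(s)s^{-k deg a}`, `u(0) = lc(a) ≠ 0`. [folklore] (new in this
form) -/
theorem exists_rows_place_normalForm (hFirr : Irreducible F) (hn : 1 ≤ F.natDegree) (R : ℂ[X][X])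
    (hR : ¬ F ∣ R) {k : ℕ} (hk : 1 ≤ k) (M : ℕ) {Φ : ℂ → ℂ} (hΦan : AnalyticAt ℂ Φ 0)
    (hplace : ∀ᶠ s in 𝓝[≠] (0 : ℂ),
      (F.map (Polynomial.evalRingHom (s ^ k)⁻¹)).eval (Φ s * (s ^ M)⁻¹) = 0) :
    ∃ (ψ : ℂ → ℂ) (L : ℤ), AnalyticAt ℂ ψ 0 ∧ ψ 0 ≠ 0 ∧
      ∀ᶠ s in 𝓝[≠] (0 : ℂ),
        (R.map (Polynomial.evalRingHom (s ^ k)⁻¹)).eval (Φ s * (s ^ M)⁻¹) = ψ s * s ^ L := by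
  classical
  obtain ⟨G, H, N, hGdeg, hGH⟩ := exists_pseudo_reduction F hn R
  set a : ℂ[X] := F.leadingCoeff with ha
  have ha0 : a ≠ 0 := by
    rw [ha, Ne, Polynomial.leadingCoeff_eq_zero]
    rintro rfl
    rw [Polynomial.natDegree_zero] at hn
    exact Nat.not_succ_le_zero 0 hn
  -- `G ≠ 0`
  have hG0 : G ≠ 0 := by
    intro hG
    rw [hG, zero_add] at hGH
    have hprime : Prime F := hFirr.prime
    have hdvd : F ∣ C (a ^ N) * R := ⟨H, by rw [hGH, mul_comm]⟩
    rcases hprime.dvd_or_dvd hdvd with h | h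
    · have := Polynomial.natDegree_le_of_dvd h (by rw [Ne, Polynomial.C_eq_zero]; exact pow_ne_zero _ ha0)
      rw [Polynomial.natDegree_C] at this
      omega
    · exact hR h
  obtain ⟨ψG, LG, hψGan, hψG0, hfG⟩ := exists_place_normalForm' F hFirr hn G hG0 hGdeg hk M hΦan hplace
  -- polar form of `a(s^{-k})`
  obtain ⟨u, huan, hu0, huev⟩ := exists_polarForm_eval a (U := fun _ : ℂ => (1 : ℂ)) analyticAt_const hk
  rw [one_pow, mul_one] at hu0
  have hu0' : u 0 ≠ 0 := by rw [hu0]; exact Polynomial.leadingCoeff_ne_zero.2 ha0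
  refine ⟨fun s => ψG s / u s ^ N, LG + (k * a.natDegree * N : ℕ), hψGan.div (huan.pow N)
    (pow_ne_zero _ hu0'), div_ne_zero hψG0 (pow_ne_zero _ hu0'), ?_⟩
  have hune : ∀ᶠ s in 𝓝 (0 : ℂ), u s ≠ 0 := huan.continuousAt.eventually_ne hu0'
  filter_upwards [hfG, hplace, self_mem_nhdsWithin, nhdsWithin_le_nhds hune] with s hsG hsF
    (hs : s ≠ 0) hus
  -- evaluate the pseudo-division identity along the place
  have hev := congrArg (fun P : ℂ[X][X] => (P.map (Polynomial.evalRingHom (s ^ k)⁻¹)).eval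
    (Φ s * (s ^ M)⁻¹)) hGH
  simp only [Polynomial.map_mul, Polynomial.map_add, Polynomial.eval_mul, Polynomial.eval_add,
    Polynomial.map_C, Polynomial.eval_C, Polynomial.coe_evalRingHom, hsF, mul_zero, add_zero, hsG,
    Polynomial.eval_pow] at hev
  have hau : a.eval (s ^ k)⁻¹ = u s * (s ^ (k * a.natDegree))⁻¹ := by
    have h := huev s hs
    rw [one_mul, inv_pow, inv_pow] at h
    exact h
  rw [hau] at hev
  have hsk : (s ^ (k * a.natDegree))⁻¹ ≠ 0 := inv_ne_zero (pow_ne_zero _ hs)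
  have huN : (u s * (s ^ (k * a.natDegree))⁻¹) ^ N ≠ 0 := pow_ne_zero _ (mul_ne_zero hus hsk)
  have hRval : (R.map (Polynomial.evalRingHom (s ^ k)⁻¹)).eval (Φ s * (s ^ M)⁻¹) =
      ψG s * s ^ LG / (u s * (s ^ (k * a.natDegree))⁻¹) ^ N :=
    eq_div_of_mul_eq huN (by rw [mul_comm]; exact hev)
  rw [hRval, zpow_add₀ hs, zpow_natCast, mul_pow, inv_pow, ← pow_mul]
  field_simp

end PlaneCurveRows

end Summit.Schanuel.Schanuel.Theorems

end
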